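import Literature.Topology.FourManifolds.MappingTorusSliverSurgery
import HarnessLib

/-!
# Regluing across the fibre sliver along a neighbourhood, and the regluing criterion

Fifth brick of the geometric core of R. Gompf, *More Cappell–Shaneson spheres are standard*,
Algebr. Geom. Topol. 10 (2010), Theorem 2.1, towards the named facts
`Literature.Topology.FourManifolds.gompf2010_framedTwist` /
`Literature.Topology.FourManifolds.gompf2010_framedTwistZero`.

`MappingTorusSliverSurgery.lean` presented the surgered mapping torus `X'` of `g ∘ φ` as an open
gluing of the surgered mapping torus `X` of `φ` minus the sliver `Σ = jB (S × {1})` and of the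
*whole* punctured second cylinder. For Theorem 2.1 one has to exhibit the same structure on `X`
itself by a diffeomorphism `G` of `X ∖ Σ` (Gompf's Lemma 2.2, extended by the identity) — and
such a `G` realises the twist only *near the sliver* (across the "front face" of the fishtail
neighbourhood's `N`), so the second piece must be a neighbourhood `V` of the sliver rather than
the whole cylinder. This file supplies both halves with an arbitrary open `V` of the second
cylinder containing the sliver and missing the base section:

* `Literature.Topology.FourManifolds.IsOpenGluingWith.sliver_reglue_surgered_opens` — **`X'` is an
  open gluing of `X ∖ Σ` and `V`** along `x ∼ b :⟺ b ∉ S × {1} ∧ x = inl (jB (sliverTwist g⁻¹ b))`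
  (as in `sliver_reglue_surgered`, which is the case `V = (M ∖ {p₀}) × (1/2, 3/2)`);
* `Literature.Topology.FourManifolds.IsOpenGluingWith.reglue_of_sliverTwisting` — **the regluing
  criterion**: if a diffeomorphism `G` of `X ∖ Σ` satisfies `G (inl (jB b)) = inl (jB (sliverTwist g b))`
  for `b ∈ V` off the sliver (and `sliverTwist g'`, `g'` a right inverse of `g`, preserves `V`), then
  `X` is an open gluing of `X ∖ Σ` (embedded by `G`) and `V` (embedded canonically) along the same
  relation. With the uniqueness of open gluings this is the last paragraph of Gompf's proof: "It
  follows that `X^ε_φ` is unchanged if we cut along this face and reglue by the given Dehn twist,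
  or equivalently, precede the surgery by cutting along an `M`-fiber and regluing by `δᵏ`."

No named facts are introduced; everything is proved.

## References

* R. E. Gompf, *More Cappell–Shaneson spheres are standard*, Algebr. Geom. Topol. 10 (2010)
  1665–1681: Lemma 2.2 and the proof of Thm 2.1 (last paragraph). [GompfAGT2010]
* A. Kosinski, *Differential Manifolds* (1993), Ch. VI §1. [Kosinski1993]
-/

open scoped Manifold ContDiff Topology
open Set Function

noncomputable section

namespace Literature.Topology.FourManifolds

universe u

/-- Local notation: `𝔼 n` is the model Euclidean space `EuclideanSpace ℝ (Fin n)`. -/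
local notation "𝔼 " n:arg => EuclideanSpace ℝ (Fin n)

/-- Local notation: `𝕊 n` is the unit sphere in `EuclideanSpace ℝ (Fin (n + 1))`. -/
local notation "𝕊 " n:arg => (Metric.sphere (0 : EuclideanSpace ℝ (Fin (n + 1))) 1)

attribute [local instance] fact_finrank_euclideanSpace_succ

/-! ### An open subset of the second cylinder inside the complement of the circle -/

section Opens

variable {M : Type*} [TopologicalSpace M]
  {T' : Type u} [TopologicalSpace T'] [T2Space T'] [ChartedSpace (𝔼 4) T'] {c' : 𝕊 1 → T'}
  (ν' : CircleNbhd (𝓡 4) c') (jB' : M × ↥mappingTorusPieceTwo → T')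
  (V : TopologicalSpace.Opens (M × ↥mappingTorusPieceTwo)) (hVc : ∀ b ∈ V, jB' b ∉ range c')

/-- **An open subset `V` of the second cylinder, missing the circle, inside the complement of the
circle**: `b ↦ jB' b` as a map `V → T' ∖ c'`. [folklore] -/
def opensToComplement (b : ↥V) : ↥ν'.complement :=
  ⟨jB' b, (ν'.mem_complement_iff _).2 (hVc b b.2)⟩

/-- The value of `opensToComplement`. [folklore] -/
@[simp] theorem coe_opensToComplement (b : ↥V) : (opensToComplement ν' jB' V hVc b : T') = jB' b :=
  rfl

variable {E H : Type*} [NormedAddCommGroup E] [NormedSpace ℝ E] [TopologicalSpace H]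
  {I : ModelWithCorners ℝ E H} [ChartedSpace H M] [IsManifold I ∞ M] [IsManifold (𝓡 4) ∞ T']

omit [T2Space T'] [IsManifold (𝓡 4) ∞ T'] in
/-- Restricting a smooth embedding to an open subset of the source gives a smooth embedding. [folklore] -/
theorem isSmoothEmbedding_comp_val_opens {X : Type*} [TopologicalSpace X] [ChartedSpace H X]
    [IsManifold I ∞ X] (W : TopologicalSpace.Opens X) {f : X → T'}
    (hf : Manifold.IsSmoothEmbedding I (𝓡 4) ∞ f) :
    Manifold.IsSmoothEmbedding I (𝓡 4) ∞ (f ∘ (Subtype.val : ↥W → X)) := by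
  rcases isEmpty_or_nonempty ↥W with hE | hne
  · exact ⟨Manifold.IsImmersionOfComplement.isImmersion (F := Unit) fun x ↦ isEmptyElim x,
      hf.isEmbedding.comp Topology.IsEmbedding.subtypeVal⟩
  · have hΦ := hf.comp_openPartialHomeomorph (W.openPartialHomeomorphSubtypeCoe hne) (by simp)
      (contMDiffOn_openPartialHomeomorphSubtypeCoe _ hne)
      (contMDiffOn_openPartialHomeomorphSubtypeCoe_symm _ hne)
    rwa [TopologicalSpace.Opens.openPartialHomeomorphSubtypeCoe_coe] at hΦ

/-- **`opensToComplement` is a smooth embedding** when `jB'` is. [folklore] -/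
theorem isSmoothEmbedding_opensToComplement
    (hB' : Manifold.IsSmoothEmbedding (I.prod 𝓘(ℝ, ℝ)) (𝓡 4) ∞ jB') :
    Manifold.IsSmoothEmbedding (I.prod 𝓘(ℝ, ℝ)) (𝓡 4) ∞ (opensToComplement ν' jB' V hVc) :=
  (isSmoothEmbedding_comp_val_opens V hB').codRestrict_opens ν'.complement fun b ↦
    (ν'.mem_complement_iff _).2 (hVc b b.2)

omit [IsManifold I ∞ M] [IsManifold (𝓡 4) ∞ T'] [ChartedSpace H M] in
/-- The range of `opensToComplement` is open when `jB'` is an open embedding. [folklore] -/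
theorem isOpen_range_opensToComplement (hB' : Topology.IsOpenEmbedding jB') :
    IsOpen (range (opensToComplement ν' jB' V hVc)) := by
  have hr : range (opensToComplement ν' jB' V hVc) =
      Subtype.val ⁻¹' (jB' '' (V : Set (M × ↥mappingTorusPieceTwo))) := by
    ext a'
    constructor
    · rintro ⟨b, rfl⟩
      exact ⟨b, b.2, rfl⟩
    · rintro ⟨b, hbW, hb⟩
      exact ⟨⟨b, hbW⟩, Subtype.ext hb⟩
  rw [hr]
  exact (hB'.isOpenMap _ V.2).preimage continuous_subtype_val

end Opens

/-! ### The surgered regluing along a neighbourhood of the sliver -/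

section Surgered

variable {E H : Type*} [NormedAddCommGroup E] [NormedSpace ℝ E] [TopologicalSpace H]
  {I : ModelWithCorners ℝ E H} {M : Type*} [TopologicalSpace M] [ChartedSpace H M]
  [IsManifold I ∞ M]
  {T T' : Type u} [TopologicalSpace T] [T2Space T] [ChartedSpace (𝔼 4) T] [IsManifold (𝓡 4) ∞ T]
  [TopologicalSpace T'] [T2Space T'] [ChartedSpace (𝔼 4) T'] [IsManifold (𝓡 4) ∞ T']
  {φ : M → M} (g : M ≃ₘ⟮I, I⟯ M)
  {jA : M × ↥mappingTorusPieceOne → T} {jB : M × ↥mappingTorusPieceTwo → T}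
  {jA' : M × ↥mappingTorusPieceOne → T'} {jB' : M × ↥mappingTorusPieceTwo → T'}

/-- **Regluing a surgered mapping torus across a fibre sliver, along a neighbourhood `V` of the
sliver** (Gompf 2010, proof of Thm 2.1, last paragraph). As `sliver_reglue_surgered`, with the
punctured second cylinder replaced by any open `V` containing the sliver `S × {1}` and missing
the circle: the surgered manifold `ν'.Surgered` of `T'` is an open gluing of
`(T ∖ jB (S × {1}))` surgered along `ν` and of `V`, by `Ψ` and `inl' ∘ jB'`, along
`x ∼ b :⟺ b ∉ S × {1} ∧ x = inl (jB (sliverTwist g⁻¹ b))`. [cite: GompfAGT2010, Thm 2.1 (proof, last paragraph)] -/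
theorem IsOpenGluingWith.sliver_reglue_surgered_opens
    (h : IsOpenGluingWith (I.prod 𝓘(ℝ, ℝ)) (I.prod 𝓘(ℝ, ℝ)) (𝓡 4) (mappingTorusRel φ) jA jB)
    (h' : IsOpenGluingWith (I.prod 𝓘(ℝ, ℝ)) (I.prod 𝓘(ℝ, ℝ)) (𝓡 4) (mappingTorusRel (g ∘ φ))
      jA' jB')
    {S : Set M} (hc : IsClosed (jB '' fibreSliver S)) (hc' : IsClosed (jB' '' fibreSliver S))
    (Θ : ↥(sliverCompl jB S hc) ≃ₘ⟮𝓡 4, 𝓡 4⟯ ↥(sliverCompl jB' S hc'))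
    (hΘA : ∀ (u : ↥(sliverCompl jB S hc)) (a : M × ↥mappingTorusPieceOne),
      (u : T) = jA a → (Θ u : T') = jA' a)
    (hΘB : ∀ (u : ↥(sliverCompl jB S hc)) (b : M × ↥mappingTorusPieceTwo),
      (u : T) = jB b → (Θ u : T') = jB' (sliverTwist g b))
    {c : 𝕊 1 → T} (ν : CircleNbhd (𝓡 4) c) {c' : 𝕊 1 → T'} (ν' : CircleNbhd (𝓡 4) c')
    (hνU : ∀ q, ν.toFun q ∈ sliverCompl jB S hc)
    (hΘν : ∀ q, ((Θ ⟨ν.toFun q, hνU q⟩ : ↥(sliverCompl jB' S hc')) : T') = ν'.toFun q)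
    (Ψ : ↥(ν.localOpens (sliverCompl jB S hc)) ≃ₘ⟮𝓡 4, 𝓡 4⟯
      ↥(ν'.localOpens (sliverCompl jB' S hc')))
    (hΨl : ∀ (x : ↥(ν.localOpens (sliverCompl jB S hc))) (a : ↥ν.complement),
      (x : ν.Surgered) = ν.glueData.inl a →
        (Ψ x : ν'.Surgered) = ν'.glueData.inl (ν.complementExtend ν' Θ hνU hΘν a))
    (hΨr : ∀ (x : ↥(ν.localOpens (sliverCompl jB S hc))) (d : ↥discTimesSphere),
      (x : ν.Surgered) = ν.glueData.inr d → (Ψ x : ν'.Surgered) = ν'.glueData.inr d)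
    (V : TopologicalSpace.Opens (M × ↥mappingTorusPieceTwo)) (hVS : fibreSliver S ⊆ V)
    (hVc : ∀ b ∈ V, jB' b ∉ range c') :
    IsOpenGluingWith (𝓡 4) (I.prod 𝓘(ℝ, ℝ)) (𝓡 4)
      (fun (x : ↥(ν.localOpens (sliverCompl jB S hc))) (b : ↥V) ↦
        (b : M × ↥mappingTorusPieceTwo) ∉ fibreSliver S ∧
          ∃ a : ↥ν.complement, (a : T) = jB (sliverTwist g.symm b) ∧
            (x : ν.Surgered) = ν.glueData.inl a)
      (fun x ↦ (Ψ x : ν'.Surgered)) (ν'.glueData.inl ∘ opensToComplement ν' jB' V hVc) := by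
  have hSR := h.sliver_reglue g h' hc hc' Θ hΘA hΘB
  have hiff : ∀ (u : ↥(sliverCompl jB S hc)) (b : M × ↥mappingTorusPieceTwo),
      (Θ u : T') = jB' b ↔ b ∉ fibreSliver S ∧ (u : T) = jB (sliverTwist g.symm b) :=
    hSR.2.2.2.2.2
  obtain ⟨-, -, hB', hBo', -, -⟩ := h'
  have hW := ν.glueData.isOpenGluingWith ν.circleSurgeryRel_iff
  have hW' := ν'.glueData.isOpenGluingWith ν'.circleSurgeryRel_iff
  refine ⟨(Manifold.IsSmoothEmbedding.of_opens (ν'.localOpens (sliverCompl jB' S hc'))).comp_diffeomorph Ψ, ?_,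
    ν'.glueData.isSmoothEmbedding_inl_comp (isSmoothEmbedding_opensToComplement ν' jB' V hVc hB'),
    ?_, ?_, fun x b ↦ ?_⟩
  · have hr : range (fun x ↦ (Ψ x : ν'.Surgered)) =
        (ν'.localOpens (sliverCompl jB' S hc') : Set ν'.Surgered) := by
      ext p
      constructor
      · rintro ⟨x, rfl⟩
        exact (Ψ x).2
      · intro hp
        exact ⟨Ψ.symm ⟨p, hp⟩, by
          show ((Ψ (Ψ.symm ⟨p, hp⟩) : ↥(ν'.localOpens (sliverCompl jB' S hc'))) : ν'.Surgered) = p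
          rw [Diffeomorph.apply_symm_apply]⟩
    rw [hr]
    exact (ν'.localOpens (sliverCompl jB' S hc')).2
  · rw [range_comp]
    exact ν'.glueData.isOpenMap_inl _
      (isOpen_range_opensToComplement ν' jB' V hVc ⟨hB'.isEmbedding, hBo'⟩)
  · -- the two ranges cover `ν'.Surgered`
    refine eq_univ_iff_forall.2 fun p ↦ ?_
    by_cases hp : p ∈ ν'.localOpens (sliverCompl jB' S hc')
    · exact Or.inl ⟨Ψ.symm ⟨p, hp⟩, by
        show ((Ψ (Ψ.symm ⟨p, hp⟩) : ↥(ν'.localOpens (sliverCompl jB' S hc'))) : ν'.Surgered) = p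
        rw [Diffeomorph.apply_symm_apply]⟩
    · right
      rcases ν'.glueData.exists_inl_or_inr p with ⟨a', rfl⟩ | ⟨d, rfl⟩
      · have ha' : (a' : T') ∉ sliverCompl jB' S hc' := fun ha' ↦ hp (ν'.inl_mem_localOpens ha')
        rw [mem_sliverCompl_iff, not_not] at ha'
        obtain ⟨b, hbS, hb⟩ := ha'
        refine ⟨⟨b, hVS hbS⟩, ?_⟩
        rw [comp_apply]
        congr 1
        exact Subtype.ext hb
      · exact absurd (ν'.inr_mem_localOpens d) hp
  · -- the relation
    show (Ψ x : ν'.Surgered) = ν'.glueData.inl (opensToComplement ν' jB' V hVc b) ↔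
      ((b : M × ↥mappingTorusPieceTwo) ∉ fibreSliver S ∧
        ∃ a : ↥ν.complement, (a : T) = jB (sliverTwist g.symm b) ∧
          (x : ν.Surgered) = ν.glueData.inl a)
    rcases (ν.mem_localOpens_iff).1 x.2 with ⟨a, ha, hxa⟩ | ⟨d, hxd⟩
    · rw [hΨl x a hxa.symm, ν'.glueData.inl_injective.eq_iff, Subtype.ext_iff,
        CircleNbhd.coe_complementExtend, coe_opensToComplement,
        CircleNbhd.extendMap_of_mem ν' Θ ha, hiff]
      refine and_congr_right fun _ ↦ ⟨fun h1 ↦ ⟨a, h1, hxa.symm⟩, ?_⟩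
      rintro ⟨a₁, ha₁, hx₁⟩
      rw [← hxa, ν.glueData.inl_injective.eq_iff] at hx₁
      subst hx₁
      exact ha₁
    · rw [hΨr x d hxd.symm, eq_comm, hW'.2.2.2.2.2]
      constructor
      · rintro ⟨w, t, ht, hd, hq⟩
        rw [coe_opensToComplement, ← hΘν, eq_comm, hiff] at hq
        refine ⟨hq.1, ⟨ν.toFun (w, t • ((d : (𝔼 2) × (𝕊 2)).2 : 𝔼 3)),
          (ν.mem_complement_iff _).2 (ν.apply_smul_sphere_not_mem w ht.1 _)⟩, hq.2, ?_⟩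
        rw [← hxd, eq_comm, hW.2.2.2.2.2]
        exact ⟨w, t, ht, hd, rfl⟩
      · rintro ⟨hbS, a₁, ha₁, hx₁⟩
        rw [← hxd, eq_comm, hW.2.2.2.2.2] at hx₁
        obtain ⟨w, t, ht, hd, hq⟩ := hx₁
        refine ⟨w, t, ht, hd, ?_⟩
        rw [coe_opensToComplement, ← hΘν, eq_comm, hiff]
        refine ⟨hbS, ?_⟩
        change ν.toFun (w, t • ((d : (𝔼 2) × (𝕊 2)).2 : 𝔼 3)) = jB (sliverTwist g.symm b)
        rw [← hq]
        exact ha₁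

end Surgered

/-! ### The regluing criterion -/

section Criterion

variable {E H : Type*} [NormedAddCommGroup E] [NormedSpace ℝ E] [TopologicalSpace H]
  {I : ModelWithCorners ℝ E H} {M : Type*} [TopologicalSpace M] [ChartedSpace H M]
  [IsManifold I ∞ M]
  {T : Type u} [TopologicalSpace T] [T2Space T] [ChartedSpace (𝔼 4) T] [IsManifold (𝓡 4) ∞ T]
  {φ : M → M} (g : M → M) {jA : M × ↥mappingTorusPieceOne → T} {jB : M × ↥mappingTorusPieceTwo → T}

/-- A point `inl a` of the surgered manifold with `a` outside `U` is not in `U` surgered (the tube,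
hence the glued part, lies in `U`). [folklore] -/
theorem CircleNbhd.inl_not_mem_localOpens {c : 𝕊 1 → T} (ν : CircleNbhd (𝓡 4) c)
    {U : TopologicalSpace.Opens T} (hνU : ∀ q, ν.toFun q ∈ U) {a : ↥ν.complement} (ha : (a : T) ∉ U) :
    ν.glueData.inl a ∉ ν.localOpens U := by
  have hW := ν.glueData.isOpenGluingWith ν.circleSurgeryRel_iff
  rintro (⟨a', ha', h⟩ | ⟨d, h⟩)
  · exact ha ((ν.glueData.inl_injective h) ▸ ha')
  · obtain ⟨w, t, -, -, hq⟩ := (hW.2.2.2.2.2 a d).1 h.symm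
    exact ha (hq ▸ hνU _)

/-- **The regluing criterion.** Let `X = ν.Surgered` be the surgered mapping torus of `φ`
(witnesses `jA, jB`), `S ⊆ M` with the sliver `Σ = jB (S × {1})` closed and missing the tube `ν`,
`V` an open subset of the second cylinder containing the sliver and missing the circle `c`, and
`g` a map of the fibre with a right inverse `g'` such that `sliverTwist g'` preserves `V`. If a
diffeomorphism `G` of the surgered open set `X ∖ Σ = ν.localOpens (sliverCompl jB S hc)` **twists
across the sliver on `V`** — `G (inl (jB b)) = inl (jB (sliverTwist g b))` for `b ∈ V` off the
sliver — then `X` is an open gluing of `X ∖ Σ` (embedded by `G`) and `V` (embedded canonically)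
along the regluing relation `x ∼ b :⟺ b ∉ S × {1} ∧ x = inl (jB (sliverTwist g' b))` of
`sliver_reglue_surgered_opens`. This is what Gompf's Lemma 2.2 provides for `X^ε_φ`: the
diffeomorphism of the fishtail neighbourhood realising the Dehn twist across the front face of
`∂N` (a neighbourhood of the sliver), extended by the identity (proof of Thm 2.1, last paragraph:
"`X^ε_φ` is unchanged if we cut along this face and reglue by the given Dehn twist"); with
`sliver_reglue_surgered_opens` and the uniqueness of open gluings it gives `X ≅ X'`. [cite: GompfAGT2010, Lemma 2.2 and Thm 2.1 (proof, last paragraph)] -/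
theorem IsOpenGluingWith.reglue_of_sliverTwisting
    (h : IsOpenGluingWith (I.prod 𝓘(ℝ, ℝ)) (I.prod 𝓘(ℝ, ℝ)) (𝓡 4) (mappingTorusRel φ) jA jB)
    {g' : M → M} (hgg' : ∀ y, g (g' y) = y)
    {S : Set M} (hc : IsClosed (jB '' fibreSliver S))
    {c : 𝕊 1 → T} (ν : CircleNbhd (𝓡 4) c) (hνU : ∀ q, ν.toFun q ∈ sliverCompl jB S hc)
    (V : TopologicalSpace.Opens (M × ↥mappingTorusPieceTwo)) (hVS : fibreSliver S ⊆ V)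
    (hVc : ∀ b ∈ V, jB b ∉ range c) (hVg' : ∀ b ∈ V, sliverTwist g' b ∈ V)
    (G : ↥(ν.localOpens (sliverCompl jB S hc)) ≃ₘ⟮𝓡 4, 𝓡 4⟯ ↥(ν.localOpens (sliverCompl jB S hc)))
    (hG : ∀ (x : ↥(ν.localOpens (sliverCompl jB S hc))) (b : ↥V),
      (b : M × ↥mappingTorusPieceTwo) ∉ fibreSliver S →
        (x : ν.Surgered) = ν.glueData.inl (opensToComplement ν jB V hVc b) →
          ∃ a' : ↥ν.complement, (a' : T) = jB (sliverTwist g b) ∧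
            (G x : ν.Surgered) = ν.glueData.inl a') :
    IsOpenGluingWith (𝓡 4) (I.prod 𝓘(ℝ, ℝ)) (𝓡 4)
      (fun (x : ↥(ν.localOpens (sliverCompl jB S hc))) (b : ↥V) ↦
        (b : M × ↥mappingTorusPieceTwo) ∉ fibreSliver S ∧
          ∃ a : ↥ν.complement, (a : T) = jB (sliverTwist g' b) ∧
            (x : ν.Surgered) = ν.glueData.inl a)
      (fun x ↦ (G x : ν.Surgered)) (ν.glueData.inl ∘ opensToComplement ν jB V hVc) := by
  obtain ⟨-, -, hB, hBo, -, -⟩ := h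
  -- points `inl (jB b)` with `b ∈ V` off the sliver lie in `U` surgered
  have hmemU : ∀ b : ↥V, (b : M × ↥mappingTorusPieceTwo) ∉ fibreSliver S →
      ν.glueData.inl (opensToComplement ν jB V hVc b) ∈ ν.localOpens (sliverCompl jB S hc) :=
    fun b hb ↦ by
    refine ν.inl_mem_localOpens ?_
    rw [coe_opensToComplement, mem_sliverCompl_iff]
    rintro ⟨b', hb', hbb⟩
    exact hb ((hB.isEmbedding.injective hbb) ▸ hb')
  refine ⟨(Manifold.IsSmoothEmbedding.of_opens (ν.localOpens (sliverCompl jB S hc))).comp_diffeomorph G,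
    ?_, ν.glueData.isSmoothEmbedding_inl_comp (isSmoothEmbedding_opensToComplement ν jB V hVc hB),
    ?_, ?_, fun x b ↦ ?_⟩
  · have hr : range (fun x ↦ (G x : ν.Surgered)) =
        (ν.localOpens (sliverCompl jB S hc) : Set ν.Surgered) := by
      ext p
      constructor
      · rintro ⟨x, rfl⟩
        exact (G x).2
      · intro hp
        exact ⟨G.symm ⟨p, hp⟩, by
          show ((G (G.symm ⟨p, hp⟩) : ↥(ν.localOpens (sliverCompl jB S hc))) : ν.Surgered) = p
          rw [Diffeomorph.apply_symm_apply]⟩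
    rw [hr]
    exact (ν.localOpens (sliverCompl jB S hc)).2
  · rw [range_comp]
    exact ν.glueData.isOpenMap_inl _
      (isOpen_range_opensToComplement ν jB V hVc ⟨hB.isEmbedding, hBo⟩)
  · -- cover: a point outside `U` surgered is `inl (jB b)` with `b ∈ Σ ⊆ V`
    refine eq_univ_iff_forall.2 fun p ↦ ?_
    by_cases hp : p ∈ ν.localOpens (sliverCompl jB S hc)
    · exact Or.inl ⟨G.symm ⟨p, hp⟩, by
        show ((G (G.symm ⟨p, hp⟩) : ↥(ν.localOpens (sliverCompl jB S hc))) : ν.Surgered) = p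
        rw [Diffeomorph.apply_symm_apply]⟩
    · right
      rcases ν.glueData.exists_inl_or_inr p with ⟨a', rfl⟩ | ⟨d, rfl⟩
      · have ha' : (a' : T) ∉ sliverCompl jB S hc := fun ha' ↦ hp (ν.inl_mem_localOpens ha')
        rw [mem_sliverCompl_iff, not_not] at ha'
        obtain ⟨b, hbS, hb⟩ := ha'
        refine ⟨⟨b, hVS hbS⟩, ?_⟩
        rw [comp_apply]
        congr 1
        exact Subtype.ext hb
      · exact absurd (ν.inr_mem_localOpens d) hp
  · -- the relation
    show (G x : ν.Surgered) = ν.glueData.inl (opensToComplement ν jB V hVc b) ↔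
      ((b : M × ↥mappingTorusPieceTwo) ∉ fibreSliver S ∧
        ∃ a : ↥ν.complement, (a : T) = jB (sliverTwist g' b) ∧
          (x : ν.Surgered) = ν.glueData.inl a)
    -- `b₀ = sliverTwist g' b` lies in `V`, and `sliverTwist g b₀ = b`
    have hgb : sliverTwist g (sliverTwist g' (b : M × ↥mappingTorusPieceTwo)) = b :=
      sliverTwist_sliverTwist_of_leftInverse hgg' _
    let b₀ : ↥V := ⟨sliverTwist g' b, hVg' b b.2⟩
    have hb₀S : (b : M × ↥mappingTorusPieceTwo) ∉ fibreSliver S →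
        (b₀ : M × ↥mappingTorusPieceTwo) ∉ fibreSliver S := fun hbS ↦ by
      show sliverTwist g' (b : M × ↥mappingTorusPieceTwo) ∉ fibreSliver S
      rwa [sliverTwist_mem_fibreSliver_iff]
    have hcyl : ∀ a' : ↥ν.complement, (a' : T) = jB (sliverTwist g b₀) →
        a' = opensToComplement ν jB V hVc b := fun a' ha' ↦
      Subtype.ext (by rw [ha', coe_opensToComplement]; exact congrArg jB hgb)
    constructor
    · intro hGx
      have hbS : (b : M × ↥mappingTorusPieceTwo) ∉ fibreSliver S := fun hbS ↦
        ν.inl_not_mem_localOpens hνU (a := opensToComplement ν jB V hVc b)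
          (by rw [coe_opensToComplement, mem_sliverCompl_iff, not_not]; exact ⟨b, hbS, rfl⟩)
          (hGx ▸ (G x).2)
      obtain ⟨a', ha', hGx₀⟩ := hG ⟨_, hmemU b₀ (hb₀S hbS)⟩ b₀ (hb₀S hbS) rfl
      rw [hcyl a' ha', ← hGx] at hGx₀
      have hxx : (⟨_, hmemU b₀ (hb₀S hbS)⟩ : ↥(ν.localOpens (sliverCompl jB S hc))) = x :=
        G.injective (Subtype.ext hGx₀)
      refine ⟨hbS, opensToComplement ν jB V hVc b₀, rfl, ?_⟩
      rw [← hxx]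
    · rintro ⟨hbS, a, ha, hx⟩
      have haeq : a = opensToComplement ν jB V hVc b₀ := Subtype.ext (by rw [ha]; rfl)
      rw [haeq] at hx
      obtain ⟨a', ha', hGx⟩ := hG x b₀ (hb₀S hbS) hx
      rw [hGx, hcyl a' ha']

end Criterion

end Literature.Topology.FourManifolds
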